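import Summits.NavierStokesRegularity.NavierStokesRegularity.Theorems.TerminalTraceTypeITraceScarL3SqrtTwoApexSliceIdentities
import Literature.Analysis.FluidPDE.PressurePoissonRegion
import HarnessLib

/-!
# The shell bounds of ROUND-27 «THE √2 APEX» (T27-A′, step (ii)′): the sources `S₁, S₂` of the cut-off
# energy / enstrophy identities live on the annulus `{ρ₁ ≤ |y| ≤ ρ₂}` and are bounded by sup norms there and
# by the shell `L¹` budget of the pressure (item `TerminalTrace.TypeITraceScarL3`,
# stmt-NavierStokesRegularity-18385, Stub LOUD line; helpers)

Seat nsreg-C26-p1 g2 (cell ns-regularity-ideate), `--supports stmt-NavierStokesRegularity-18385` (helper);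
planner-of-record nsreg-p2 g29 (ROUND-27 §1 (ii)–(iii)).  ONE TIME SLICE, as in `…SqrtTwoApexSliceIdentities`:
smooth `V` with `div V = 0`, a smooth cut-off `φ` with `φ = 1` on `|y| ≤ ρ₁` and `φ = 0` on `|y| ≥ ρ₂`
(`0 < ρ₁ < ρ₂`), `w = φV`, the annulus `K = {ρ₁ ≤ |y| ≤ ρ₂}`.

* generic: `abs_integral_le_of_eq_zero_off` (`|∫ g| ≤ B·|K|` if `g = 0` off `K` and `|g| ≤ B` on `K`) and
  `abs_integral_mul_le_of_shell` (`|∫ q g| ≤ B·m_P` if moreover `∫ g = 0` and `∫_K |q − c| ≤ m_P`: the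
  pressure enters only through its gauge-free shell budget).
* support: the commutator `Δw − φΔV`, the weights `∂_Vφ`, `∂_Vφ²` and `div(φΔw)` VANISH OFF `K`
  (inside `|y| < ρ₁` one has `w = V` near the point and `div ΔV = Δ div V = 0`,
  tree `divergence_laplacian_eq_zero_of_eventually`; outside `|y| > ρ₂` everything vanishes near the point).
* `abs_shellSource₁_le` / `abs_shellSource₂_le` — **the bounds**: with sup bounds `B` on `K` for
  `V, ΔV, Δw, D(Δw)`, `0 ≤ φ ≤ 1`, `‖Dφ‖ ≤ C_φ`, and the shell budget `∫_K |q − c| ≤ m_P`,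
  `|−∫⟪w, Δw − φΔV⟫ + ½∫(∂_Vφ²)‖V‖² + ∫ q ∂_Vφ²| ≤ (2B² + C_φB³)|K| + 2C_φB·m_P` and
  `|−∫⟪Δw, Δw − φΔV⟫ + ∫⟪Δw, (∂_Vφ)V⟫ + ∫ q div(φΔw)| ≤ (2B² + C_φB³)|K| + (3 + C_φ)B·m_P`.

WHAT THIS IS NOT: not T27-A′, not T27-A, not NS regularity — bookkeeping of shell terms.  [folklore]
-/

noncomputable section

set_option linter.dupNamespace false

namespace Summit.NavierStokesRegularity.NavierStokesRegularity.Theorems.TypeITraceScarL3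

open MeasureTheory Set Function Filter Topology Metric InnerProductSpace
open Literature.Analysis.FluidPDE
open scoped RealInnerProductSpace Laplacian ContDiff

/-! ### Generic shell estimates -/

/-- `|∫ g| ≤ B · |K|` when `g` vanishes off the compact `K` and `|g| ≤ B` on `K`. [folklore] -/
theorem abs_integral_le_of_eq_zero_off {g : EuclideanSpace ℝ (Fin 3) → ℝ} {K : Set (EuclideanSpace ℝ (Fin 3))}
    (hK : IsCompact K) {B : ℝ} (hg0 : ∀ y ∉ K, g y = 0) (hgB : ∀ y ∈ K, |g y| ≤ B) :
    |∫ y, g y| ≤ B * (volume K).toReal := by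
  rw [← setIntegral_eq_integral_of_forall_compl_eq_zero (s := K) fun y hy => hg0 y hy, ← Real.norm_eq_abs]
  exact norm_setIntegral_le_of_norm_le_const hK.measure_lt_top fun y hy => by
    rw [Real.norm_eq_abs]; exact hgB y hy

/-- **The pressure enters only through its shell budget**: `|∫ q g| ≤ B · m_P` when `g` is continuous,
vanishes off the compact `K`, `|g| ≤ B` on `K`, `∫ g = 0`, and `∫_K |q − c| ≤ m_P`. [folklore] -/
theorem abs_integral_mul_le_of_shell {q g : EuclideanSpace ℝ (Fin 3) → ℝ} {K : Set (EuclideanSpace ℝ (Fin 3))}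
    (hK : IsCompact K) (hq : Continuous q) (hg : Continuous g) {B : ℝ} (hB : 0 ≤ B)
    (hg0 : ∀ y ∉ K, g y = 0) (hgB : ∀ y ∈ K, |g y| ≤ B) (hgi : ∫ y, g y = 0)
    {c mP : ℝ} (hP : ∫ y in K, |q y - c| ≤ mP) : |∫ y, q y * g y| ≤ B * mP := by
  have hgc : HasCompactSupport g := HasCompactSupport.intro hK hg0
  have i1 : Integrable (fun y => q y * g y) (volume : Measure (EuclideanSpace ℝ (Fin 3))) :=
    (hq.mul hg).integrable_of_hasCompactSupport hgc.mul_left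
  have i2 : Integrable (fun y => (q y - c) * g y) (volume : Measure (EuclideanSpace ℝ (Fin 3))) :=
    ((hq.sub continuous_const).mul hg).integrable_of_hasCompactSupport hgc.mul_left
  have e1 : ∫ y, q y * g y = ∫ y, (q y - c) * g y := by
    have h : ∫ y, (q y - c) * g y = (∫ y, q y * g y) - c * ∫ y, g y := by
      rw [← integral_const_mul, ← integral_sub i1 ((hg.integrable_of_hasCompactSupport hgc).const_mul c)]
      exact integral_congr_ae (Eventually.of_forall fun y => by ring)
    rw [h, hgi, mul_zero, sub_zero]
  rw [e1, ← setIntegral_eq_integral_of_forall_compl_eq_zero (s := K) fun y hy => by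
    show (q y - c) * g y = 0
    rw [hg0 y hy, mul_zero]]
  have hqi : IntegrableOn (fun y => |q y - c|) K volume :=
    (hq.sub continuous_const).abs.continuousOn.integrableOn_compact hK
  calc |∫ y in K, (q y - c) * g y| ≤ ∫ y in K, |(q y - c) * g y| := abs_integral_le_integral_abs
    _ ≤ ∫ y in K, |q y - c| * B := by
        refine setIntegral_mono_on (i2.abs.integrableOn) (hqi.mul_const B) hK.measurableSet fun y hy => ?_
        rw [abs_mul]
        exact mul_le_mul_of_nonneg_left (hgB y hy) (abs_nonneg _)
    _ = (∫ y in K, |q y - c|) * B := integral_mul_const B _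
    _ ≤ mP * B := mul_le_mul_of_nonneg_right hP hB
    _ = B * mP := mul_comm _ _

/-- `|div F(y)| ≤ 3 ‖DF(y)‖` on `ℝ³` (trace against operator norm). [folklore] -/
private theorem abs_divergence_le_three_mul (F : EuclideanSpace ℝ (Fin 3) → EuclideanSpace ℝ (Fin 3))
    (y : EuclideanSpace ℝ (Fin 3)) : |VectorCalculus.divergence F y| ≤ 3 * ‖fderiv ℝ F y‖ := by
  set b := EuclideanSpace.basisFun (Fin 3) ℝ
  rw [divergence_eq_sum_inner_fderiv b]
  calc |∑ i, ⟪b i, fderiv ℝ F y (b i)⟫| ≤ ∑ i, |⟪b i, fderiv ℝ F y (b i)⟫| := Finset.abs_sum_le_sum_abs _ _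
    _ ≤ ∑ _i : Fin 3, ‖fderiv ℝ F y‖ := Finset.sum_le_sum fun i _ => by
        calc |⟪b i, fderiv ℝ F y (b i)⟫| ≤ ‖b i‖ * ‖fderiv ℝ F y (b i)‖ := abs_real_inner_le_norm _ _
          _ ≤ ‖b i‖ * (‖fderiv ℝ F y‖ * ‖b i‖) :=
              mul_le_mul_of_nonneg_left (ContinuousLinearMap.le_opNorm _ _) (norm_nonneg _)
          _ = ‖fderiv ℝ F y‖ := by rw [b.orthonormal.1 i]; ring
    _ = 3 * ‖fderiv ℝ F y‖ := by simp

/-! ### The annulus and the support of the shell terms -/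

section Annulus

variable {V : EuclideanSpace ℝ (Fin 3) → EuclideanSpace ℝ (Fin 3)} {φ : EuclideanSpace ℝ (Fin 3) → ℝ}
  {ρ₁ ρ₂ : ℝ}

/-- Inside the inner ball the cut-off is `1` near every point. -/
theorem cutoff_eventuallyEq_one (hφ1 : ∀ y : EuclideanSpace ℝ (Fin 3), ‖y‖ ≤ ρ₁ → φ y = 1)
    {y : EuclideanSpace ℝ (Fin 3)} (hy : ‖y‖ < ρ₁) : φ =ᶠ[𝓝 y] fun _ => (1 : ℝ) := by
  filter_upwards [(isOpen_lt continuous_norm continuous_const).mem_nhds hy] with z hz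
  exact hφ1 z (le_of_lt hz)

/-- Outside the outer ball the cut-off is `0` near every point. -/
theorem cutoff_eventuallyEq_zero (hφ0 : ∀ y : EuclideanSpace ℝ (Fin 3), ρ₂ ≤ ‖y‖ → φ y = 0)
    {y : EuclideanSpace ℝ (Fin 3)} (hy : ρ₂ < ‖y‖) : φ =ᶠ[𝓝 y] fun _ => (0 : ℝ) := by
  filter_upwards [(isOpen_lt continuous_const continuous_norm).mem_nhds hy] with z hz
  exact hφ0 z (le_of_lt hz)

/-- A point off the annulus `{ρ₁ ≤ |y| ≤ ρ₂}` is inside the inner ball or outside the outer ball. -/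
theorem lt_or_lt_of_notMem_annulus {y : EuclideanSpace ℝ (Fin 3)}
    (hy : y ∉ {y : EuclideanSpace ℝ (Fin 3) | ρ₁ ≤ ‖y‖ ∧ ‖y‖ ≤ ρ₂}) : ‖y‖ < ρ₁ ∨ ρ₂ < ‖y‖ := by
  simp only [mem_setOf_eq, not_and_or, not_le] at hy
  exact hy

/-- The annulus is compact. -/
theorem isCompact_annulus (ρ₁ ρ₂ : ℝ) :
    IsCompact {y : EuclideanSpace ℝ (Fin 3) | ρ₁ ≤ ‖y‖ ∧ ‖y‖ ≤ ρ₂} := by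
  have hsub : {y : EuclideanSpace ℝ (Fin 3) | ρ₁ ≤ ‖y‖ ∧ ‖y‖ ≤ ρ₂} ⊆ closedBall 0 ρ₂ := fun y hy => by
    rw [mem_closedBall_zero_iff]; exact hy.2
  exact (isCompact_closedBall _ _).of_isClosed_subset
    ((isClosed_le continuous_const continuous_norm).inter (isClosed_le continuous_norm continuous_const)) hsub

/-- The derivative of the cut-off vanishes off the annulus. -/
theorem fderiv_cutoff_eq_zero_off (hφ1 : ∀ y : EuclideanSpace ℝ (Fin 3), ‖y‖ ≤ ρ₁ → φ y = 1)
    (hφ0 : ∀ y : EuclideanSpace ℝ (Fin 3), ρ₂ ≤ ‖y‖ → φ y = 0) {y : EuclideanSpace ℝ (Fin 3)}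
    (hy : y ∉ {y : EuclideanSpace ℝ (Fin 3) | ρ₁ ≤ ‖y‖ ∧ ‖y‖ ≤ ρ₂}) : fderiv ℝ φ y = 0 := by
  rcases lt_or_lt_of_notMem_annulus hy with h | h
  · rw [(cutoff_eventuallyEq_one hφ1 h).fderiv_eq, fderiv_const_apply]
  · rw [(cutoff_eventuallyEq_zero hφ0 h).fderiv_eq, fderiv_const_apply]

/-- `∂_v φ² = 2 φ ∂_v φ`. -/
theorem fderiv_cutoff_sq_apply (hφ : ContDiff ℝ ∞ φ) (y v : EuclideanSpace ℝ (Fin 3)) :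
    fderiv ℝ (fun y => φ y ^ 2) y v = 2 * φ y * fderiv ℝ φ y v := by
  have hd : DifferentiableAt ℝ φ y := hφ.differentiable (by simp) y
  have e : (fun y => φ y ^ 2) = fun y => φ y * φ y := by funext y; ring
  rw [e, fderiv_fun_mul hd hd, _root_.add_apply, _root_.smul_apply, smul_eq_mul]
  ring

/-- The derivative of `φ²` vanishes off the annulus. -/
theorem fderiv_cutoff_sq_eq_zero_off (hφ : ContDiff ℝ ∞ φ)
    (hφ1 : ∀ y : EuclideanSpace ℝ (Fin 3), ‖y‖ ≤ ρ₁ → φ y = 1)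
    (hφ0 : ∀ y : EuclideanSpace ℝ (Fin 3), ρ₂ ≤ ‖y‖ → φ y = 0) {y : EuclideanSpace ℝ (Fin 3)}
    (hy : y ∉ {y : EuclideanSpace ℝ (Fin 3) | ρ₁ ≤ ‖y‖ ∧ ‖y‖ ≤ ρ₂}) (v : EuclideanSpace ℝ (Fin 3)) :
    fderiv ℝ (fun y => φ y ^ 2) y v = 0 := by
  rw [fderiv_cutoff_sq_apply hφ, fderiv_cutoff_eq_zero_off hφ1 hφ0 hy]
  simp

/-- **The commutator `Δw − φΔV` vanishes off the annulus** (`w = V` near points of the inner ball,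
`w = 0` near points outside the outer ball). -/
theorem laplacian_cutoff_sub_eq_zero_off
    (hφ1 : ∀ y : EuclideanSpace ℝ (Fin 3), ‖y‖ ≤ ρ₁ → φ y = 1)
    (hφ0 : ∀ y : EuclideanSpace ℝ (Fin 3), ρ₂ ≤ ‖y‖ → φ y = 0) {y : EuclideanSpace ℝ (Fin 3)}
    (hy : y ∉ {y : EuclideanSpace ℝ (Fin 3) | ρ₁ ≤ ‖y‖ ∧ ‖y‖ ≤ ρ₂}) :
    (Δ (fun y => φ y • V y)) y - φ y • (Δ V) y = 0 := by
  rcases lt_or_lt_of_notMem_annulus hy with h | h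
  · have hev : (fun y => φ y • V y) =ᶠ[𝓝 y] V := by
      filter_upwards [cutoff_eventuallyEq_one hφ1 h] with z hz
      rw [hz, one_smul]
    rw [(InnerProductSpace.laplacian_congr_nhds hev).eq_of_nhds, hφ1 y h.le, one_smul, sub_self]
  · have hev : (fun y => φ y • V y) =ᶠ[𝓝 y] fun _ => (0 : EuclideanSpace ℝ (Fin 3)) := by
      filter_upwards [cutoff_eventuallyEq_zero hφ0 h] with z hz
      rw [hz, zero_smul]
    rw [(InnerProductSpace.laplacian_congr_nhds hev).eq_of_nhds, hφ0 y h.le, zero_smul, sub_zero]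
    exact laplacian_eq_zero_of_notMem_tsupport (by simp)

/-- **The pressure weight `div(φΔw)` vanishes off the annulus** (`div ΔV = Δ div V = 0` inside, tree
`divergence_laplacian_eq_zero_of_eventually`). -/
theorem divergence_cutoff_laplacian_eq_zero_off (hV : ContDiff ℝ ∞ V) (hdiv : VectorCalculus.IsDivFree V)
    (hφ1 : ∀ y : EuclideanSpace ℝ (Fin 3), ‖y‖ ≤ ρ₁ → φ y = 1)
    (hφ0 : ∀ y : EuclideanSpace ℝ (Fin 3), ρ₂ ≤ ‖y‖ → φ y = 0) {y : EuclideanSpace ℝ (Fin 3)}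
    (hy : y ∉ {y : EuclideanSpace ℝ (Fin 3) | ρ₁ ≤ ‖y‖ ∧ ‖y‖ ≤ ρ₂}) :
    VectorCalculus.divergence (fun y => φ y • (Δ (fun y => φ y • V y)) y) y = 0 := by
  rcases lt_or_lt_of_notMem_annulus hy with h | h
  · -- inside: `φ Δw = ΔV` near `y`, and `div ΔV (y) = 0`
    have hev1 := cutoff_eventuallyEq_one hφ1 h
    have hevw : (fun y => φ y • V y) =ᶠ[𝓝 y] V := by
      filter_upwards [hev1] with z hz
      rw [hz, one_smul]
    have hevΔ : (fun y => φ y • (Δ (fun y => φ y • V y)) y) =ᶠ[𝓝 y] Δ V := by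
      filter_upwards [hev1, InnerProductSpace.laplacian_congr_nhds hevw] with z hz1 hz2
      rw [hz1, one_smul, hz2]
    unfold VectorCalculus.divergence
    rw [hevΔ.fderiv_eq]
    exact divergence_laplacian_eq_zero_of_eventually (hV.of_le (by norm_cast))
      (Eventually.of_forall fun z => hdiv z)
  · have hev : (fun y => φ y • (Δ (fun y => φ y • V y)) y) =ᶠ[𝓝 y]
        fun _ => (0 : EuclideanSpace ℝ (Fin 3)) := by
      filter_upwards [cutoff_eventuallyEq_zero hφ0 h] with z hz
      rw [hz, zero_smul]
    unfold VectorCalculus.divergence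
    rw [hev.fderiv_eq, fderiv_const_apply]
    simp

end Annulus


/-! ### The two shell-source bounds -/

section Bounds

variable {V : EuclideanSpace ℝ (Fin 3) → EuclideanSpace ℝ (Fin 3)} {q φ : EuclideanSpace ℝ (Fin 3) → ℝ}
  {ρ₁ ρ₂ B Cφ c mP : ℝ}

/-- **Bound on the energy source `S₁`** (module docstring). [folklore] -/
theorem abs_shellSource₁_le (hV : ContDiff ℝ ∞ V) (hdiv : VectorCalculus.IsDivFree V) (hq : Continuous q)
    (hφ : ContDiff ℝ ∞ φ) (hφ1 : ∀ y : EuclideanSpace ℝ (Fin 3), ‖y‖ ≤ ρ₁ → φ y = 1)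
    (hφ0 : ∀ y : EuclideanSpace ℝ (Fin 3), ρ₂ ≤ ‖y‖ → φ y = 0)
    (hφ01 : ∀ y, 0 ≤ φ y ∧ φ y ≤ 1) (hCφ : 0 ≤ Cφ) (hdφ : ∀ y, ‖fderiv ℝ φ y‖ ≤ Cφ) (hB : 0 ≤ B)
    (hVB : ∀ y ∈ {y : EuclideanSpace ℝ (Fin 3) | ρ₁ ≤ ‖y‖ ∧ ‖y‖ ≤ ρ₂}, ‖V y‖ ≤ B)
    (hΔVB : ∀ y ∈ {y : EuclideanSpace ℝ (Fin 3) | ρ₁ ≤ ‖y‖ ∧ ‖y‖ ≤ ρ₂}, ‖(Δ V) y‖ ≤ B)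
    (hΔwB : ∀ y ∈ {y : EuclideanSpace ℝ (Fin 3) | ρ₁ ≤ ‖y‖ ∧ ‖y‖ ≤ ρ₂}, ‖(Δ (fun y => φ y • V y)) y‖ ≤ B)
    (hP : ∫ y in {y : EuclideanSpace ℝ (Fin 3) | ρ₁ ≤ ‖y‖ ∧ ‖y‖ ≤ ρ₂}, |q y - c| ≤ mP) :
    |-(∫ y, ⟪φ y • V y, (Δ (fun y => φ y • V y)) y - φ y • (Δ V) y⟫) +
        (1 / 2) * (∫ y, fderiv ℝ (fun y => φ y ^ 2) y (V y) * ‖V y‖ ^ 2) +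
        ∫ y, q y * fderiv ℝ (fun y => φ y ^ 2) y (V y)| ≤
      (2 * B ^ 2 + Cφ * B ^ 3) * (volume {y : EuclideanSpace ℝ (Fin 3) | ρ₁ ≤ ‖y‖ ∧ ‖y‖ ≤ ρ₂}).toReal +
        2 * Cφ * B * mP := by
  have hKc : IsCompact {y : EuclideanSpace ℝ (Fin 3) | ρ₁ ≤ ‖y‖ ∧ ‖y‖ ≤ ρ₂} := isCompact_annulus ρ₁ ρ₂
  have hvol : 0 ≤ (volume {y : EuclideanSpace ℝ (Fin 3) | ρ₁ ≤ ‖y‖ ∧ ‖y‖ ≤ ρ₂}).toReal := ENNReal.toReal_nonneg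
  have hφle : ∀ y, |φ y| ≤ 1 := fun y => abs_le.2 ⟨by linarith [(hφ01 y).1], (hφ01 y).2⟩
  have hdφV : ∀ y, |fderiv ℝ φ y (V y)| ≤ Cφ * ‖V y‖ := fun y => by
    rw [← Real.norm_eq_abs]
    exact (ContinuousLinearMap.le_opNorm _ _).trans (mul_le_mul_of_nonneg_right (hdφ y) (norm_nonneg _))
  have hdφ2 : ∀ y, |fderiv ℝ (fun y => φ y ^ 2) y (V y)| ≤ 2 * Cφ * ‖V y‖ := by
    intro y
    rw [fderiv_cutoff_sq_apply hφ, abs_mul, abs_mul, abs_two]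
    calc 2 * |φ y| * |fderiv ℝ φ y (V y)| ≤ 2 * 1 * (Cφ * ‖V y‖) :=
          mul_le_mul (mul_le_mul_of_nonneg_left (hφle y) (by norm_num)) (hdφV y) (abs_nonneg _) (by norm_num)
      _ = 2 * Cφ * ‖V y‖ := by ring
  -- term 1: the commutator pairing
  have h1a : ∀ y ∉ {y : EuclideanSpace ℝ (Fin 3) | ρ₁ ≤ ‖y‖ ∧ ‖y‖ ≤ ρ₂}, ⟪φ y • V y, (Δ (fun y => φ y • V y)) y - φ y • (Δ V) y⟫ = 0 := fun y hy => by
    rw [laplacian_cutoff_sub_eq_zero_off (V := V) hφ1 hφ0 hy, inner_zero_right]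
  have h1b : ∀ y ∈ {y : EuclideanSpace ℝ (Fin 3) | ρ₁ ≤ ‖y‖ ∧ ‖y‖ ≤ ρ₂}, |⟪φ y • V y, (Δ (fun y => φ y • V y)) y - φ y • (Δ V) y⟫| ≤ 2 * B ^ 2 := by
    intro y hy
    have ha : |⟪φ y • V y, (Δ (fun y => φ y • V y)) y - φ y • (Δ V) y⟫| ≤
        ‖φ y • V y‖ * ‖(Δ (fun y => φ y • V y)) y - φ y • (Δ V) y‖ := abs_real_inner_le_norm _ _
    have hb : ‖φ y • V y‖ ≤ 1 * B := by
      rw [norm_smul, Real.norm_eq_abs]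
      exact mul_le_mul (hφle y) (hVB y hy) (norm_nonneg _) zero_le_one
    have hc : ‖(Δ (fun y => φ y • V y)) y - φ y • (Δ V) y‖ ≤ B + 1 * B := by
      refine (norm_sub_le _ _).trans (add_le_add (hΔwB y hy) ?_)
      rw [norm_smul, Real.norm_eq_abs]
      exact mul_le_mul (hφle y) (hΔVB y hy) (norm_nonneg _) zero_le_one
    have hd : ‖φ y • V y‖ * ‖(Δ (fun y => φ y • V y)) y - φ y • (Δ V) y‖ ≤ (1 * B) * (B + 1 * B) :=
      mul_le_mul hb hc (norm_nonneg _) (by positivity)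
    nlinarith [ha, hd]
  have h1 : |∫ y, ⟪φ y • V y, (Δ (fun y => φ y • V y)) y - φ y • (Δ V) y⟫| ≤
      2 * B ^ 2 * (volume {y : EuclideanSpace ℝ (Fin 3) | ρ₁ ≤ ‖y‖ ∧ ‖y‖ ≤ ρ₂}).toReal := abs_integral_le_of_eq_zero_off hKc h1a h1b
  -- term 2: the drift weight
  have h2a : ∀ y ∉ {y : EuclideanSpace ℝ (Fin 3) | ρ₁ ≤ ‖y‖ ∧ ‖y‖ ≤ ρ₂}, fderiv ℝ (fun y => φ y ^ 2) y (V y) * ‖V y‖ ^ 2 = 0 := fun y hy => by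
    rw [fderiv_cutoff_sq_eq_zero_off hφ hφ1 hφ0 hy, zero_mul]
  have h2b : ∀ y ∈ {y : EuclideanSpace ℝ (Fin 3) | ρ₁ ≤ ‖y‖ ∧ ‖y‖ ≤ ρ₂}, |fderiv ℝ (fun y => φ y ^ 2) y (V y) * ‖V y‖ ^ 2| ≤ 2 * Cφ * B ^ 3 := by
    intro y hy
    rw [abs_mul, abs_of_nonneg (by positivity : (0 : ℝ) ≤ ‖V y‖ ^ 2)]
    have h3 : ‖V y‖ ^ 3 ≤ B ^ 3 := pow_le_pow_left₀ (norm_nonneg _) (hVB y hy) 3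
    calc |fderiv ℝ (fun y => φ y ^ 2) y (V y)| * ‖V y‖ ^ 2 ≤ (2 * Cφ * ‖V y‖) * ‖V y‖ ^ 2 :=
          mul_le_mul_of_nonneg_right (hdφ2 y) (by positivity)
      _ = 2 * Cφ * ‖V y‖ ^ 3 := by ring
      _ ≤ 2 * Cφ * B ^ 3 := by nlinarith
  have h2 : |∫ y, fderiv ℝ (fun y => φ y ^ 2) y (V y) * ‖V y‖ ^ 2| ≤
      2 * Cφ * B ^ 3 * (volume {y : EuclideanSpace ℝ (Fin 3) | ρ₁ ≤ ‖y‖ ∧ ‖y‖ ≤ ρ₂}).toReal := abs_integral_le_of_eq_zero_off hKc h2a h2b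
  -- term 3: the pressure pairing, weight `∂_V φ² = div(φ² V)`
  have hφ2 : ContDiff ℝ ∞ (fun y => φ y ^ 2) := hφ.pow 2
  have hg3c : Continuous fun y => fderiv ℝ (fun y => φ y ^ 2) y (V y) :=
    ((hφ2.of_le (by norm_cast : (1 : WithTop ℕ∞) ≤ ∞)).continuous_fderiv one_ne_zero).clm_apply
      hV.continuous
  have hφc : HasCompactSupport φ := by
    refine HasCompactSupport.intro (isCompact_closedBall (0 : EuclideanSpace ℝ (Fin 3)) ρ₂) fun y hy => ?_
    rw [mem_closedBall_zero_iff, not_le] at hy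
    exact hφ0 y hy.le
  have hg3i : ∫ y, fderiv ℝ (fun y => φ y ^ 2) y (V y) = 0 := by
    have hdiv_eq : ∀ y, VectorCalculus.divergence (fun y => φ y ^ 2 • V y) y =
        fderiv ℝ (fun y => φ y ^ 2) y (V y) := fun y => by
      rw [divergence_smul_apply ((hφ2.differentiable (by simp)) y) (hV.differentiable (by simp) y), hdiv y,
        mul_zero, zero_add, real_inner_comm, gradient, InnerProductSpace.toDual_symm_apply]
    rw [← integral_congr_ae (Eventually.of_forall hdiv_eq)]
    refine integral_divergence_eq_zero ((hφ2.of_le (by norm_cast)).smul (hV.of_le (by norm_cast))) ?_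
    exact HasCompactSupport.intro hφc fun y hy => by
      rw [image_eq_zero_of_notMem_tsupport hy]; simp
  have h3b : ∀ y ∈ {y : EuclideanSpace ℝ (Fin 3) | ρ₁ ≤ ‖y‖ ∧ ‖y‖ ≤ ρ₂}, |fderiv ℝ (fun y => φ y ^ 2) y (V y)| ≤ 2 * Cφ * B := fun y hy =>
    (hdφ2 y).trans (by nlinarith [hVB y hy])
  have h3 : |∫ y, q y * fderiv ℝ (fun y => φ y ^ 2) y (V y)| ≤ 2 * Cφ * B * mP :=
    abs_integral_mul_le_of_shell hKc hq hg3c (by positivity)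
      (fun y hy => fderiv_cutoff_sq_eq_zero_off hφ hφ1 hφ0 hy _) h3b hg3i hP
  -- assemble
  have hA := abs_add_three
    (-(∫ y, ⟪φ y • V y, (Δ (fun y => φ y • V y)) y - φ y • (Δ V) y⟫))
    ((1 / 2) * (∫ y, fderiv ℝ (fun y => φ y ^ 2) y (V y) * ‖V y‖ ^ 2))
    (∫ y, q y * fderiv ℝ (fun y => φ y ^ 2) y (V y))
  rw [abs_neg, abs_mul, abs_of_pos (by norm_num : (0 : ℝ) < 1 / 2)] at hA
  nlinarith [hA, h1, h2, h3]

/-- **Bound on the enstrophy source `S₂`** (module docstring). [folklore] -/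
theorem abs_shellSource₂_le (hV : ContDiff ℝ ∞ V) (hdiv : VectorCalculus.IsDivFree V) (hq : Continuous q)
    (hφ : ContDiff ℝ ∞ φ) (hφ1 : ∀ y : EuclideanSpace ℝ (Fin 3), ‖y‖ ≤ ρ₁ → φ y = 1)
    (hφ0 : ∀ y : EuclideanSpace ℝ (Fin 3), ρ₂ ≤ ‖y‖ → φ y = 0)
    (hφ01 : ∀ y, 0 ≤ φ y ∧ φ y ≤ 1) (hCφ : 0 ≤ Cφ) (hdφ : ∀ y, ‖fderiv ℝ φ y‖ ≤ Cφ) (hB : 0 ≤ B)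
    (hVB : ∀ y ∈ {y : EuclideanSpace ℝ (Fin 3) | ρ₁ ≤ ‖y‖ ∧ ‖y‖ ≤ ρ₂}, ‖V y‖ ≤ B)
    (hΔVB : ∀ y ∈ {y : EuclideanSpace ℝ (Fin 3) | ρ₁ ≤ ‖y‖ ∧ ‖y‖ ≤ ρ₂}, ‖(Δ V) y‖ ≤ B)
    (hΔwB : ∀ y ∈ {y : EuclideanSpace ℝ (Fin 3) | ρ₁ ≤ ‖y‖ ∧ ‖y‖ ≤ ρ₂}, ‖(Δ (fun y => φ y • V y)) y‖ ≤ B)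
    (hDΔwB : ∀ y ∈ {y : EuclideanSpace ℝ (Fin 3) | ρ₁ ≤ ‖y‖ ∧ ‖y‖ ≤ ρ₂}, ‖fderiv ℝ (Δ (fun y => φ y • V y)) y‖ ≤ B)
    (hP : ∫ y in {y : EuclideanSpace ℝ (Fin 3) | ρ₁ ≤ ‖y‖ ∧ ‖y‖ ≤ ρ₂}, |q y - c| ≤ mP) :
    |-(∫ y, ⟪(Δ (fun y => φ y • V y)) y, (Δ (fun y => φ y • V y)) y - φ y • (Δ V) y⟫) +
        (∫ y, ⟪(Δ (fun y => φ y • V y)) y, (fderiv ℝ φ y (V y)) • V y⟫) +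
        ∫ y, q y * VectorCalculus.divergence (fun y => φ y • (Δ (fun y => φ y • V y)) y) y| ≤
      (2 * B ^ 2 + Cφ * B ^ 3) * (volume {y : EuclideanSpace ℝ (Fin 3) | ρ₁ ≤ ‖y‖ ∧ ‖y‖ ≤ ρ₂}).toReal +
        (3 + Cφ) * B * mP := by
  have hKc : IsCompact {y : EuclideanSpace ℝ (Fin 3) | ρ₁ ≤ ‖y‖ ∧ ‖y‖ ≤ ρ₂} := isCompact_annulus ρ₁ ρ₂
  have hvol : 0 ≤ (volume {y : EuclideanSpace ℝ (Fin 3) | ρ₁ ≤ ‖y‖ ∧ ‖y‖ ≤ ρ₂}).toReal := ENNReal.toReal_nonneg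
  have hφle : ∀ y, |φ y| ≤ 1 := fun y => abs_le.2 ⟨by linarith [(hφ01 y).1], (hφ01 y).2⟩
  have hw : ContDiff ℝ ∞ (fun y => φ y • V y) := hφ.smul hV
  have hΔw : ContDiff ℝ ∞ (Δ (fun y => φ y • V y)) :=
    contDiff_infty.2 fun n => contDiff_laplacian (n := n) (contDiff_infty.1 hw (n + 2))
  have hdφV : ∀ y, |fderiv ℝ φ y (V y)| ≤ Cφ * ‖V y‖ := fun y => by
    rw [← Real.norm_eq_abs]
    exact (ContinuousLinearMap.le_opNorm _ _).trans (mul_le_mul_of_nonneg_right (hdφ y) (norm_nonneg _))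
  -- term 1
  have h1a : ∀ y ∉ {y : EuclideanSpace ℝ (Fin 3) | ρ₁ ≤ ‖y‖ ∧ ‖y‖ ≤ ρ₂},
      ⟪(Δ (fun y => φ y • V y)) y, (Δ (fun y => φ y • V y)) y - φ y • (Δ V) y⟫ = 0 := fun y hy => by
    rw [laplacian_cutoff_sub_eq_zero_off (V := V) hφ1 hφ0 hy, inner_zero_right]
  have h1b : ∀ y ∈ {y : EuclideanSpace ℝ (Fin 3) | ρ₁ ≤ ‖y‖ ∧ ‖y‖ ≤ ρ₂},
      |⟪(Δ (fun y => φ y • V y)) y, (Δ (fun y => φ y • V y)) y - φ y • (Δ V) y⟫| ≤ 2 * B ^ 2 := by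
    intro y hy
    have ha : |⟪(Δ (fun y => φ y • V y)) y, (Δ (fun y => φ y • V y)) y - φ y • (Δ V) y⟫| ≤
        ‖(Δ (fun y => φ y • V y)) y‖ * ‖(Δ (fun y => φ y • V y)) y - φ y • (Δ V) y‖ :=
      abs_real_inner_le_norm _ _
    have hc : ‖(Δ (fun y => φ y • V y)) y - φ y • (Δ V) y‖ ≤ B + 1 * B := by
      refine (norm_sub_le _ _).trans (add_le_add (hΔwB y hy) ?_)
      rw [norm_smul, Real.norm_eq_abs]
      exact mul_le_mul (hφle y) (hΔVB y hy) (norm_nonneg _) zero_le_one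
    have hd : ‖(Δ (fun y => φ y • V y)) y‖ * ‖(Δ (fun y => φ y • V y)) y - φ y • (Δ V) y‖ ≤
        B * (B + 1 * B) := mul_le_mul (hΔwB y hy) hc (norm_nonneg _) hB
    nlinarith [ha, hd]
  have h1 : |∫ y, ⟪(Δ (fun y => φ y • V y)) y, (Δ (fun y => φ y • V y)) y - φ y • (Δ V) y⟫| ≤
      2 * B ^ 2 * (volume {y : EuclideanSpace ℝ (Fin 3) | ρ₁ ≤ ‖y‖ ∧ ‖y‖ ≤ ρ₂}).toReal := abs_integral_le_of_eq_zero_off hKc h1a h1b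
  -- term 2
  have h2a : ∀ y ∉ {y : EuclideanSpace ℝ (Fin 3) | ρ₁ ≤ ‖y‖ ∧ ‖y‖ ≤ ρ₂}, ⟪(Δ (fun y => φ y • V y)) y, (fderiv ℝ φ y (V y)) • V y⟫ = 0 := fun y hy => by
    rw [fderiv_cutoff_eq_zero_off hφ1 hφ0 hy, _root_.zero_apply, zero_smul, inner_zero_right]
  have h2b : ∀ y ∈ {y : EuclideanSpace ℝ (Fin 3) | ρ₁ ≤ ‖y‖ ∧ ‖y‖ ≤ ρ₂}, |⟪(Δ (fun y => φ y • V y)) y, (fderiv ℝ φ y (V y)) • V y⟫| ≤ Cφ * B ^ 3 := by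
    intro y hy
    have ha : |⟪(Δ (fun y => φ y • V y)) y, (fderiv ℝ φ y (V y)) • V y⟫| ≤
        ‖(Δ (fun y => φ y • V y)) y‖ * ‖(fderiv ℝ φ y (V y)) • V y‖ := abs_real_inner_le_norm _ _
    have hb : ‖(fderiv ℝ φ y (V y)) • V y‖ ≤ (Cφ * B) * B := by
      rw [norm_smul, Real.norm_eq_abs]
      exact mul_le_mul ((hdφV y).trans (mul_le_mul_of_nonneg_left (hVB y hy) hCφ)) (hVB y hy)
        (norm_nonneg _) (by positivity)
    have hd : ‖(Δ (fun y => φ y • V y)) y‖ * ‖(fderiv ℝ φ y (V y)) • V y‖ ≤ B * ((Cφ * B) * B) :=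
      mul_le_mul (hΔwB y hy) hb (norm_nonneg _) hB
    nlinarith [ha, hd]
  have h2 : |∫ y, ⟪(Δ (fun y => φ y • V y)) y, (fderiv ℝ φ y (V y)) • V y⟫| ≤
      Cφ * B ^ 3 * (volume {y : EuclideanSpace ℝ (Fin 3) | ρ₁ ≤ ‖y‖ ∧ ‖y‖ ≤ ρ₂}).toReal := abs_integral_le_of_eq_zero_off hKc h2a h2b
  -- term 3: weight `div(φ Δw) = φ div(Δw) + ∂_{Δw} φ`
  have hg3c : Continuous (VectorCalculus.divergence fun y => φ y • (Δ (fun y => φ y • V y)) y) :=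
    continuous_divergence (((hφ.of_le (by norm_cast : (1 : WithTop ℕ∞) ≤ ∞)).smul
      (hΔw.of_le (by norm_cast))).continuous_fderiv one_ne_zero)
  have hg3i : ∫ y, VectorCalculus.divergence (fun y => φ y • (Δ (fun y => φ y • V y)) y) y = 0 := by
    refine integral_divergence_eq_zero ((hφ.of_le (by norm_cast)).smul (hΔw.of_le (by norm_cast))) ?_
    have hws : HasCompactSupport (fun y => φ y • V y) := by
      refine HasCompactSupport.intro (isCompact_closedBall (0 : EuclideanSpace ℝ (Fin 3)) ρ₂) fun y hy => ?_
      rw [mem_closedBall_zero_iff, not_le] at hy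
      rw [hφ0 y hy.le, zero_smul]
    have hΔws : HasCompactSupport (Δ (fun y => φ y • V y)) :=
      HasCompactSupport.intro hws fun y hy => laplacian_eq_zero_of_notMem_tsupport hy
    exact HasCompactSupport.intro hΔws fun y hy => by rw [image_eq_zero_of_notMem_tsupport hy, smul_zero]
  have h3b : ∀ y ∈ {y : EuclideanSpace ℝ (Fin 3) | ρ₁ ≤ ‖y‖ ∧ ‖y‖ ≤ ρ₂},
      |VectorCalculus.divergence (fun y => φ y • (Δ (fun y => φ y • V y)) y) y| ≤ (3 + Cφ) * B := by
    intro y hy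
    rw [divergence_smul_apply (hφ.differentiable (by simp) y) (hΔw.differentiable (by simp) y),
      real_inner_comm, gradient, InnerProductSpace.toDual_symm_apply]
    have ha : |φ y * VectorCalculus.divergence (Δ (fun y => φ y • V y)) y| ≤ 1 * (3 * B) := by
      rw [abs_mul]
      exact mul_le_mul (hφle y) ((abs_divergence_le_three_mul _ y).trans (by linarith [hDΔwB y hy]))
        (abs_nonneg _) zero_le_one
    have hb : |fderiv ℝ φ y ((Δ (fun y => φ y • V y)) y)| ≤ Cφ * B := by
      rw [← Real.norm_eq_abs]
      exact (ContinuousLinearMap.le_opNorm _ _).trans (mul_le_mul (hdφ y) (hΔwB y hy) (norm_nonneg _) hCφ)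
    calc _ ≤ |φ y * VectorCalculus.divergence (Δ (fun y => φ y • V y)) y| +
          |fderiv ℝ φ y ((Δ (fun y => φ y • V y)) y)| := abs_add_le _ _
      _ ≤ 1 * (3 * B) + Cφ * B := add_le_add ha hb
      _ = (3 + Cφ) * B := by ring
  have h3 : |∫ y, q y * VectorCalculus.divergence (fun y => φ y • (Δ (fun y => φ y • V y)) y) y| ≤
      (3 + Cφ) * B * mP :=
    abs_integral_mul_le_of_shell hKc hq hg3c (by positivity)
      (fun y hy => divergence_cutoff_laplacian_eq_zero_off hV hdiv hφ1 hφ0 hy) h3b hg3i hP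
  have hA := abs_add_three
    (-(∫ y, ⟪(Δ (fun y => φ y • V y)) y, (Δ (fun y => φ y • V y)) y - φ y • (Δ V) y⟫))
    (∫ y, ⟪(Δ (fun y => φ y • V y)) y, (fderiv ℝ φ y (V y)) • V y⟫)
    (∫ y, q y * VectorCalculus.divergence (fun y => φ y • (Δ (fun y => φ y • V y)) y) y)
  rw [abs_neg] at hA
  nlinarith [hA, h1, h2, h3]

end Bounds

end Summit.NavierStokesRegularity.NavierStokesRegularity.Theorems.TypeITraceScarL3

end
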